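/-
Origin: expansion seat `planner-pub-hodgecm-pv14-g6-0`, handover import Pv14g6.SchrodingerSmoothVectors -> import HodgeCM.Automorphic.SchrodingerSmoothVectors ; after SchrodingerSmoothVectors (this seat row 11, same run) (`HOME/pub-hodgecm-pv14-g6/lean/Pv14g6/SchrodingerCCR.lean`, md5 a663a4d9, 150 lines);
landed by the gen-8 packager in gate run 30 as `HodgeCM/Automorphic/SchrodingerCCR.lean` (import ^import Pv14g6\.SchrodingerSmoothVectors[ \t]*$→import HodgeCM.Automorphic.SchrodingerSmoothVectors ×1).
-/
/-
Copyright (c) 2026. All rights reserved.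
Released under Apache 2.0 license as described in the file LICENSE.
Origin: pub-hodgecm-pv14-g6 (DAG-node prover #14, gen 6), file #14; target
`HodgeCM/Automorphic/SchrodingerCCR.lean` (namespace `HodgeCM.SchwartzWeil`).  NEW ADDITIVE LEAF.
-/
import Summits.HodgeConjecture.HodgeCM.Automorphic.SchrodingerSmoothVectors

/-!
# The canonical commutation relations for the infinitesimal Schrödinger representation

With `dρ_m(a,b,c) = schrodingerGen V m a b c = -∂_{a} + 2πi ⟪m b, ·⟫ + 2πi m c` on `𝓢(V, ℂ)`
(`SchrodingerInfinitesimal`, `SchrodingerSmoothVectors`) we prove: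

* `Heis.expCurve_mul_expCurve` — the group commutator of two one-parameter subgroups is central:
  `γ_{X}(s) γ_{Y}(t) = γ_{(0,0,⟪a',b⟫-⟪a,b'⟫)}(s t) γ_{Y}(t) γ_{X}(s)` for `X = (a,b,c)`, `Y = (a',b',c')`;
* `lineDerivOp_comm` — `∂_{a} ∂_{a'} = ∂_{a'} ∂_{a}` on `𝓢(V, ℂ)` (symmetry of second derivatives);
* `lineDerivOp_modGen` — Leibniz: `∂_{a} (2πi⟪c₀,·⟫ Φ) = 2πi⟪c₀,a⟫ Φ + 2πi⟪c₀,·⟫ ∂_{a} Φ`;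
* `schrodingerGen_commutator` — **CCR / Lie homomorphism on the central extension**:
  `dρ_m(X) (dρ_m(Y) Φ) - dρ_m(Y) (dρ_m(X) Φ) = dρ_m(0, 0, ⟪a',b⟫ - ⟪a,b'⟫) Φ = 2πi m (⟪a',b⟫ - ⟪a,b'⟫) • Φ`,
  i.e. `dρ_m` is a Lie algebra representation of `heis(V)` (bracket `[(a,b,c),(a',b',c')] = (0,0,⟪a',b⟫-⟪a,b'⟫)`,
  the tangent of the group commutator above) on the invariant domain `𝓢(V, ℂ)`.
-/

noncomputable section

open scoped Real FourierTransform SchwartzMap RealInnerProductSpace Topology LineDeriv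
open Complex Filter

namespace HodgeCM
namespace SchwartzWeil

variable {V : Type} [NormedAddCommGroup V] [InnerProductSpace ℝ V]

namespace Heis

/-- The commutator of two one-parameter subgroups of `Heis V` is the central one-parameter subgroup with
parameter `⟪a', b⟫ - ⟪a, b'⟫`, at time `s t`. -/
theorem expCurve_mul_expCurve (a b a' b' : V) (c c' s t : ℝ) :
    expCurve a b c s * expCurve a' b' c' t =
      expCurve 0 0 (⟪a', b⟫ - ⟪a, b'⟫) (s * t) * (expCurve a' b' c' t * expCurve a b c s) := by
  ext : 1
  · simp [add_comm]
  · simp [add_comm]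
  · simp only [mul_u, mul_b, expCurve_u, expCurve_a, expCurve_b, smul_zero, inner_zero_left,
      mul_zero, zero_div, sub_zero, neg_zero, AddChar.map_zero_eq_one, mul_one, real_inner_smul_left,
      real_inner_smul_right, ← AddChar.map_add_eq_mul]
    exact congrArg (fun r : ℝ => (𝐞 r : Circle)) (by ring)

end Heis

/-! ## Second derivatives commute on Schwartz space -/

omit [InnerProductSpace ℝ V] in
/-- `∂_{a} ∂_{a'} Φ = ∂_{a'} ∂_{a} Φ` for Schwartz `Φ`. -/
theorem lineDerivOp_comm [NormedSpace ℝ V] (a a' : V) (Φ : 𝓢(V, ℂ)) : ∂_{a} (∂_{a'} Φ) = ∂_{a'} (∂_{a} Φ) := by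
  ext x
  have hd : DifferentiableAt ℝ (fderiv ℝ (Φ : V → ℂ)) x :=
    (SchwartzMap.fderivCLM ℝ V ℂ Φ).differentiableAt
  have hsymm : IsSymmSndFDerivAt ℝ (Φ : V → ℂ) x :=
    ((Φ.smooth 2).contDiffAt (x := x)).isSymmSndFDerivAt
      (by rw [minSmoothness_of_isRCLikeNormedField]; exact_mod_cast le_rfl)
  show fderiv ℝ (fun y => fderiv ℝ (Φ : V → ℂ) y a') x a = fderiv ℝ (fun y => fderiv ℝ (Φ : V → ℂ) y a) x a'
  rw [fderiv_clm_apply hd (differentiableAt_const a'), fderiv_clm_apply hd (differentiableAt_const a)]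
  simp only [fderiv_fun_const, Pi.zero_apply, ContinuousLinearMap.comp_zero, zero_add,
    ContinuousLinearMap.flip_apply]
  exact hsymm a a'

/-! ## Leibniz rule for the modulation generator -/

/-- (Ported verbatim from the HodgeCMPerL package; no docstring in the source.) -/
theorem hasTemperateGrowth_modGen (c₀ : V) :
    (fun x : V => 2 * π * I * ((⟪c₀, x⟫ : ℝ) : ℂ)).HasTemperateGrowth := by
  fun_prop

/-- (Ported verbatim from the HodgeCMPerL package; no docstring in the source.) -/
theorem hasFDerivAt_modGen (c₀ x : V) :
    HasFDerivAt (fun x : V => 2 * π * I * ((⟪c₀, x⟫ : ℝ) : ℂ))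
      ((2 * π * I) • (Complex.ofRealCLM.comp (innerSL ℝ c₀))) x :=
  (Complex.ofRealCLM.hasFDerivAt.comp x (innerSL ℝ c₀).hasFDerivAt).const_mul (2 * π * I)

/-- `∂_{a} (2πi⟪c₀,·⟫ Φ) = 2πi⟪c₀,a⟫ • Φ + 2πi⟪c₀,·⟫ ∂_{a} Φ`. -/
theorem lineDerivOp_modGen (c₀ a : V) (Φ : 𝓢(V, ℂ)) :
    ∂_{a} (SchwartzMap.smulLeftCLM ℂ (fun x : V => 2 * π * I * ((⟪c₀, x⟫ : ℝ) : ℂ)) Φ) =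
      (2 * π * I * ((⟪c₀, a⟫ : ℝ) : ℂ)) • Φ
        + SchwartzMap.smulLeftCLM ℂ (fun x : V => 2 * π * I * ((⟪c₀, x⟫ : ℝ) : ℂ)) (∂_{a} Φ) := by
  have hg := hasTemperateGrowth_modGen c₀
  ext x
  have hF : HasFDerivAt (fun y : V => (2 * π * I * ((⟪c₀, y⟫ : ℝ) : ℂ)) • Φ y) _ x :=
    (hasFDerivAt_modGen c₀ x).smul (Φ.hasFDerivAt x)
  rw [SchwartzMap.lineDerivOp_apply_eq_fderiv, SchwartzMap.smulLeftCLM_apply hg, add_apply, smul_apply,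
    SchwartzMap.smulLeftCLM_apply_apply hg, SchwartzMap.lineDerivOp_apply_eq_fderiv, hF.fderiv]
  simp only [add_apply, FunLike.coe_smul, Pi.smul_apply,
    ContinuousLinearMap.smulRight_apply, ContinuousLinearMap.comp_apply, innerSL_apply_apply,
    Complex.ofRealCLM_apply, smul_eq_mul]
  ring

/-! ## The commutation relations -/

variable (V) (m : ℤ)

/-- (Ported verbatim from the HodgeCMPerL package; no docstring in the source.) -/
theorem schrodingerGen_central (c : ℝ) (Φ : 𝓢(V, ℂ)) :
    schrodingerGen V m 0 0 c Φ = (2 * π * I * ((m : ℝ) * c)) • Φ := by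
  have hg := hasTemperateGrowth_modGen ((m : ℝ) • (0 : V))
  ext x
  rw [schrodingerGen, add_apply, add_apply, neg_apply, smul_apply, SchwartzMap.smulLeftCLM_apply_apply hg,
    SchwartzMap.lineDerivOp_apply_eq_fderiv]
  simp

/-- **CCR.**  `dρ_m(X) dρ_m(Y) - dρ_m(Y) dρ_m(X) = 2πi m (⟪a',b⟫ - ⟪a,b'⟫)` on `𝓢(V, ℂ)`. -/
theorem schrodingerGen_commutator (a b a' b' : V) (c c' : ℝ) (Φ : 𝓢(V, ℂ)) :
    schrodingerGen V m a b c (schrodingerGen V m a' b' c' Φ)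
        - schrodingerGen V m a' b' c' (schrodingerGen V m a b c Φ) =
      (2 * π * I * ((m : ℝ) * (⟪a', b⟫ - ⟪a, b'⟫))) • Φ := by
  -- abbreviations for the two modulation generators and the two central scalars
  set G := SchwartzMap.smulLeftCLM ℂ (fun x : V => 2 * π * I * ((⟪(m : ℝ) • b, x⟫ : ℝ) : ℂ)) with hG
  set G' := SchwartzMap.smulLeftCLM ℂ (fun x : V => 2 * π * I * ((⟪(m : ℝ) • b', x⟫ : ℝ) : ℂ)) with hG'
  set κ : ℂ := 2 * π * I * ((m : ℝ) * c) with hκ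
  set κ' : ℂ := 2 * π * I * ((m : ℝ) * c') with hκ'
  have hX : ∀ Ψ : 𝓢(V, ℂ), schrodingerGen V m a b c Ψ = -∂_{a} Ψ + G Ψ + κ • Ψ := fun Ψ => rfl
  have hY : ∀ Ψ : 𝓢(V, ℂ), schrodingerGen V m a' b' c' Ψ = -∂_{a'} Ψ + G' Ψ + κ' • Ψ := fun Ψ => rfl
  have hg := hasTemperateGrowth_modGen ((m : ℝ) • b)
  have hg' := hasTemperateGrowth_modGen ((m : ℝ) • b')
  -- the three relations: `[G, G'] = 0`, `[∂_a, G'] = 2πi m ⟪a, b'⟫`, `[∂_a, ∂_{a'}] = 0`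
  have hGG' : G (G' Φ) = G' (G Φ) := by
    rw [hG, hG', SchwartzMap.smulLeftCLM_smulLeftCLM_apply hg hg',
      SchwartzMap.smulLeftCLM_smulLeftCLM_apply hg' hg, mul_comm]
  have e1 : (2 * π * I * ((⟪(m : ℝ) • b', a⟫ : ℝ) : ℂ)) = 2 * π * I * (m : ℝ) * ((⟪a, b'⟫ : ℝ) : ℂ) := by
    rw [real_inner_smul_left, real_inner_comm a b']; push_cast; ring
  have e2 : (2 * π * I * ((⟪(m : ℝ) • b, a'⟫ : ℝ) : ℂ)) = 2 * π * I * (m : ℝ) * ((⟪a', b⟫ : ℝ) : ℂ) := by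
    rw [real_inner_smul_left, real_inner_comm a' b]; push_cast; ring
  have hDG' : ∂_{a} (G' Φ) = (2 * π * I * (m : ℝ) * ((⟪a, b'⟫ : ℝ) : ℂ)) • Φ + G' (∂_{a} Φ) := by
    rw [← e1]; exact lineDerivOp_modGen _ a Φ
  have hDG : ∂_{a'} (G Φ) = (2 * π * I * (m : ℝ) * ((⟪a', b⟫ : ℝ) : ℂ)) • Φ + G (∂_{a'} Φ) := by
    rw [← e2]; exact lineDerivOp_modGen _ a' Φ
  have hDD : ∂_{a} (∂_{a'} Φ) = ∂_{a'} (∂_{a} Φ) := lineDerivOp_comm a a' Φ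
  rw [hY Φ, hX Φ, hX, hY]
  simp only [LineDeriv.lineDerivOp_add, LineDeriv.lineDerivOp_neg, LineDeriv.lineDerivOp_smul, map_add, map_neg,
    map_smul, hGG', hDG', hDG, hDD, smul_add, smul_neg]
  module

/-- The CCR in Lie-algebra form: `[dρ_m(X), dρ_m(Y)] = dρ_m([X, Y])` with
`[(a,b,c), (a',b',c')] = (0, 0, ⟪a',b⟫ - ⟪a,b'⟫)`. -/
theorem schrodingerGen_commutator' (a b a' b' : V) (c c' : ℝ) (Φ : 𝓢(V, ℂ)) :
    schrodingerGen V m a b c (schrodingerGen V m a' b' c' Φ)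
        - schrodingerGen V m a' b' c' (schrodingerGen V m a b c Φ) =
      schrodingerGen V m 0 0 (⟪a', b⟫ - ⟪a, b'⟫) Φ := by
  rw [schrodingerGen_commutator, schrodingerGen_central]
  simp only [Complex.ofReal_sub]

end SchwartzWeil
end HodgeCM
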